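import Mathlib
import Literature.Computability.AlgebraicComplexity.DetReprEquivalent
import Literature.Computability.AlgebraicComplexity.EquivariantDC
import Literature.Computability.AlgebraicComplexity.StandardFamilies

/-!
# `SymPencil.SymmetrizePermPairs` (stmt-ValiantsHypothesis-17793), line `birth_SymmetrizePermPairs`, stub `stub_induce` —
# step (I1): the INDUCED BLOCK PENCIL

Desk RULINGS #151 (w1 text) / #189 (I1); sizing memo `HOME/lmr/NOTE-p7g11-17793-stub_induce-sizing.md` §(I1).

SETTING.  `Γ' ≤ Γ ≤ GL(σ, k)` with `[Γ : Γ'] = R < ∞` (`(Γ'.subgroupOf Γ).FiniteIndex`), left cosets `Q = Γ ⧸ Γ'`, coset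
representatives `rep q := q.out`, and an `m × m` polynomial matrix `A` carrying `Γ'`-LIFTS
(`∀ γ' ∈ Γ', ∃ g h ∈ GL_m, A(γ'·x) = g · A · h⁻¹` — the lift clause of `IsEquivariantDetRepr`).  The **induced block pencil**
is `A^ind := ⊕_{q ∈ Q} A(rep q · x)`, re-indexed to `Fin (m · R)`.

RESULTS (no `sorry`, no `def`; the block pencil and its lifts are explicit terms inside the proofs, the statements are
existentials over `Matrix (Fin (m · [Γ : Γ'])) …`):
* §1 block bookkeeping on `Fin m × Q`: block permutation = `submatrix` along `(Equiv.refl (Fin m)).prodCongr τ`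
  (`blockDiagonal_submatrix_prodCongr`, `perm_conj_eq_submatrix`, `perm_mul_perm_inv`, `perm_inv_mul_perm`), the conjugation
  identity `blockLift_conj` («(blockdiag g · P_τ) · blockdiag B · (P_τ⁻¹ · blockdiag h) = blockdiag (g_q B_{τ q} h_q)»), the
  inverse pair `blockLift_mul_inv` / `blockLift_inv_mul`, and `blockLift_map_C` / `blockLift_inv_map_C`.
* §2 `inducedBlock` — **(T1) LIFTS + (T2) DETERMINANT** in one existential: for every `γ ∈ Γ` there are
  `G, H ∈ GL_{mR}(ℂ)` with `A'(γ·x) = G · A' · H⁻¹` (lift = «block-diagonal `Γ'`-lift ∘ block permutation `q ↦ γ • q`», from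
  `γ · rep q = rep (γ•q) · h_q`, `h_q ∈ Γ'`, `QuotientGroup.eq`); `det A' = ∏_{i < R} (reps i) · det A` with `reps i ∈ Γ`;
  affineness and symmetry are inherited.  `inducedBlock_of_invariant`: if `det A = f` is `Γ`-INVARIANT then `det A' = f ^ R`.
* §3 `perPoly_linSubst_permPair` — `per_n` is invariant under the row/column permutation pairs `Γ_n` (closure of
  `permMatrix (prodCongr π ρ)`, VERBATIM the Birth skeleton's `permPairSubst n`; `linSubst_permMatrix` + the reindexing
  computation of the tree's `rename_prodMap_perPoly` inlined, closure induction), hence `inducedBlock_permPairs`: for `Γ' ≤ Γ_n` of index `R` and a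
  `Γ'`-equivariant symmetric affine pencil of `per_n` of size `m`, the induced block pencil is a symmetric affine pencil of size
  `m R` with `Γ_n`-lifts and determinant `per_n ^ R` — the LOCATED OBSTRUCTION of the memo: product-type induction yields
  `per^R`, never `per` (for `R ≥ 2`), so `stub_induce` needs a SUM model ((C3) of the memo).

Helper mode (`--supports stmt-ValiantsHypothesis-17793 --as helper`).  Honest framing: bookkeeping step (I1) of an OPEN stub;
the crux `SymmetrizePermPairs`, `SdcThesis` and VP ≠ VNP are OPEN and NOT moved by this file.

## References
* [LandsbergRessayre2017] J. M. Landsberg, N. Ressayre, *Permanent v. determinant: an exponential lower bound assuming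
  symmetry and a potential path towards Valiant's conjecture*, Differential Geom. Appl. 55 (2017), Def. 1.3.
-/

open Matrix MvPolynomial
open Literature.Computability.AlgebraicComplexity

-- the mandated summit-side namespace repeats a component by design (single-problem summit)
set_option linter.dupNamespace false

namespace Summit.ValiantsHypothesis.ValiantsHypothesis.Theorems.SymPencilSymmetrizePermPairs.InducedBlock

noncomputable section

/-! ### §1 Block bookkeeping on `Fin m × Q` -/

section Blocks

variable {R : Type*} [CommRing R] {m : ℕ} {Q : Type*} [Fintype Q] [DecidableEq Q]

omit [Fintype Q] in
/-- Re-indexing the blocks of a block-diagonal matrix along a permutation `τ` of the block labels gives the block-diagonal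
matrix of the permuted family. [folklore] -/
theorem blockDiagonal_submatrix_prodCongr (B : Q → Matrix (Fin m) (Fin m) R) (τ : Equiv.Perm Q) :
    (blockDiagonal B).submatrix ((Equiv.refl (Fin m)).prodCongr τ) ((Equiv.refl (Fin m)).prodCongr τ) =
      blockDiagonal (fun q => B (τ q)) := by
  ext ⟨a, q⟩ ⟨b, q'⟩
  simp only [Matrix.submatrix_apply, Equiv.prodCongr_apply, Prod.map_apply, Equiv.coe_refl, id_eq,
    blockDiagonal_apply, τ.apply_eq_iff_eq]

/-- Conjugating by the block-permutation matrix `P_τ = 1.submatrix (id × τ) id` re-indexes: `P_τ M P_τ⁻¹ = M.submatrix e e`.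
[folklore] -/
theorem perm_conj_eq_submatrix (M : Matrix (Fin m × Q) (Fin m × Q) R) (τ : Equiv.Perm Q) :
    (1 : Matrix (Fin m × Q) (Fin m × Q) R).submatrix ((Equiv.refl (Fin m)).prodCongr τ) id * M *
      (1 : Matrix (Fin m × Q) (Fin m × Q) R).submatrix id ((Equiv.refl (Fin m)).prodCongr τ) =
      M.submatrix ((Equiv.refl (Fin m)).prodCongr τ) ((Equiv.refl (Fin m)).prodCongr τ) := by
  set e := (Equiv.refl (Fin m)).prodCongr τ with he
  have h1 : (1 : Matrix (Fin m × Q) (Fin m × Q) R).submatrix e id * M = M.submatrix e id := by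
    have := (Matrix.submatrix_mul (1 : Matrix (Fin m × Q) (Fin m × Q) R) M (e : Fin m × Q → Fin m × Q)
      (Equiv.refl (Fin m × Q)) (id : Fin m × Q → Fin m × Q) (Equiv.refl _).bijective).symm
    simpa using this
  rw [h1]
  have := (Matrix.submatrix_mul M (1 : Matrix (Fin m × Q) (Fin m × Q) R) (e : Fin m × Q → Fin m × Q)
    (Equiv.refl (Fin m × Q)) (e : Fin m × Q → Fin m × Q) (Equiv.refl _).bijective).symm
  simpa using this

/-- The two block-permutation matrices are mutually inverse. [folklore] -/
theorem perm_mul_perm_inv (τ : Equiv.Perm Q) :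
    (1 : Matrix (Fin m × Q) (Fin m × Q) R).submatrix ((Equiv.refl (Fin m)).prodCongr τ) id *
      (1 : Matrix (Fin m × Q) (Fin m × Q) R).submatrix id ((Equiv.refl (Fin m)).prodCongr τ) = 1 := by
  have h := perm_conj_eq_submatrix (1 : Matrix (Fin m × Q) (Fin m × Q) R) τ
  rwa [Matrix.mul_one, Matrix.submatrix_one_equiv] at h

/-- … and in the other order. [folklore] -/
theorem perm_inv_mul_perm (τ : Equiv.Perm Q) :
    (1 : Matrix (Fin m × Q) (Fin m × Q) R).submatrix id ((Equiv.refl (Fin m)).prodCongr τ) *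
      (1 : Matrix (Fin m × Q) (Fin m × Q) R).submatrix ((Equiv.refl (Fin m)).prodCongr τ) id = 1 := by
  set e := (Equiv.refl (Fin m)).prodCongr τ with he
  have := (Matrix.submatrix_mul (1 : Matrix (Fin m × Q) (Fin m × Q) R) 1 (id : Fin m × Q → Fin m × Q)
    e (id : Fin m × Q → Fin m × Q) e.bijective).symm
  simp only [Matrix.mul_one, Matrix.submatrix_id_id] at this
  exact this

/-- **The conjugation identity.**  `(blockdiag g · P_τ) · blockdiag B · (P_τ⁻¹ · blockdiag h) = blockdiag (g_q · B_{τ q} · h_q)`.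
[folklore] -/
theorem blockLift_conj (g h B : Q → Matrix (Fin m) (Fin m) R) (τ : Equiv.Perm Q) :
    blockDiagonal g * (1 : Matrix (Fin m × Q) (Fin m × Q) R).submatrix ((Equiv.refl (Fin m)).prodCongr τ) id *
        blockDiagonal B *
      ((1 : Matrix (Fin m × Q) (Fin m × Q) R).submatrix id ((Equiv.refl (Fin m)).prodCongr τ) * blockDiagonal h) =
      blockDiagonal (fun q => g q * B (τ q) * h q) := by
  rw [show blockDiagonal (fun q => g q * B (τ q) * h q) =
      blockDiagonal g * blockDiagonal (fun q => B (τ q)) * blockDiagonal h by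
    rw [← blockDiagonal_mul, ← blockDiagonal_mul],
    ← blockDiagonal_submatrix_prodCongr B τ, ← perm_conj_eq_submatrix (blockDiagonal B) τ]
  simp only [Matrix.mul_assoc]



/-- The block lift `blockdiag g · P_τ` is invertible with inverse `P_τ⁻¹ · blockdiag g⁻¹`. [folklore] -/
theorem blockLift_mul_inv (g gi : Q → Matrix (Fin m) (Fin m) R) (hg : ∀ q, g q * gi q = 1) (τ : Equiv.Perm Q) :
    blockDiagonal g * (1 : Matrix (Fin m × Q) (Fin m × Q) R).submatrix ((Equiv.refl (Fin m)).prodCongr τ) id *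
      ((1 : Matrix (Fin m × Q) (Fin m × Q) R).submatrix id ((Equiv.refl (Fin m)).prodCongr τ) * blockDiagonal gi) = 1 := by
  rw [Matrix.mul_assoc, ← Matrix.mul_assoc (Matrix.submatrix _ _ _), perm_mul_perm_inv, Matrix.one_mul, ← blockDiagonal_mul,
    ← blockDiagonal_one]
  congr 1
  funext q
  exact hg q

/-- … and on the other side. [folklore] -/
theorem blockLift_inv_mul (g gi : Q → Matrix (Fin m) (Fin m) R) (hg : ∀ q, gi q * g q = 1) (τ : Equiv.Perm Q) :
    (1 : Matrix (Fin m × Q) (Fin m × Q) R).submatrix id ((Equiv.refl (Fin m)).prodCongr τ) * blockDiagonal gi *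
      (blockDiagonal g * (1 : Matrix (Fin m × Q) (Fin m × Q) R).submatrix ((Equiv.refl (Fin m)).prodCongr τ) id) = 1 := by
  rw [Matrix.mul_assoc, ← Matrix.mul_assoc (blockDiagonal gi), ← blockDiagonal_mul,
    show (blockDiagonal fun q => gi q * g q) = (1 : Matrix (Fin m × Q) (Fin m × Q) R) by
      rw [← blockDiagonal_one]; congr 1; funext q; exact hg q,
    Matrix.one_mul, perm_inv_mul_perm]

/-- Constants pass through: `(blockdiag g · P_τ).map C = blockdiag (g.map C) · P_τ`. [folklore] -/
theorem blockLift_map_C {k : Type*} [CommRing k] {σ : Type*} (g : Q → Matrix (Fin m) (Fin m) k) (τ : Equiv.Perm Q) :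
    (blockDiagonal g * (1 : Matrix (Fin m × Q) (Fin m × Q) k).submatrix ((Equiv.refl (Fin m)).prodCongr τ) id).map
        (C : k → MvPolynomial σ k) =
      blockDiagonal (fun q => (g q).map C) *
        (1 : Matrix (Fin m × Q) (Fin m × Q) (MvPolynomial σ k)).submatrix ((Equiv.refl (Fin m)).prodCongr τ) id := by
  rw [Matrix.map_mul, blockDiagonal_map _ _ (map_zero C), ← Matrix.submatrix_map, Matrix.map_one C (map_zero C) (map_one C)]

/-- Constants pass through: `(P_τ⁻¹ · blockdiag g).map C = P_τ⁻¹ · blockdiag (g.map C)`. [folklore] -/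
theorem blockLift_inv_map_C {k : Type*} [CommRing k] {σ : Type*} (g : Q → Matrix (Fin m) (Fin m) k) (τ : Equiv.Perm Q) :
    ((1 : Matrix (Fin m × Q) (Fin m × Q) k).submatrix id ((Equiv.refl (Fin m)).prodCongr τ) * blockDiagonal g).map
        (C : k → MvPolynomial σ k) =
      (1 : Matrix (Fin m × Q) (Fin m × Q) (MvPolynomial σ k)).submatrix id ((Equiv.refl (Fin m)).prodCongr τ) *
        blockDiagonal (fun q => (g q).map C) := by
  rw [Matrix.map_mul, blockDiagonal_map _ _ (map_zero C), ← Matrix.submatrix_map, Matrix.map_one C (map_zero C) (map_one C)]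

end Blocks

/-! ### §2 The induced block pencil: lifts, affineness, symmetry, determinant -/

section Induced

variable {σ : Type*} [Fintype σ] [DecidableEq σ] {m : ℕ}

/-- **(I1) The induced block pencil.**  For `Γ' ≤ Γ ≤ GL(σ, ℂ)` of finite index `R` and an `m × m` polynomial matrix `A`
with `Γ'`-lifts, the block pencil `A' = ⊕_{q ∈ Γ/Γ'} A(rep q · x)` (size `m · R`) has `Γ`-LIFTS («block-diagonal lift ∘ block
permutation»), its determinant is the product of the `R` translates `(rep q) · det A` by elements `rep q ∈ Γ`, and it is affine
/ symmetric when `A` is. [cite: LandsbergRessayre2017, Def. 1.3] -/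
theorem inducedBlock (Γ Γ' : Subgroup (GL σ ℂ)) [hfi : (Γ'.subgroupOf Γ).FiniteIndex]
    (A : Matrix (Fin m) (Fin m) (MvPolynomial σ ℂ))
    (hlift : ∀ γ ∈ Γ', ∃ g h : GL (Fin m) ℂ,
      Matrix.linSubstEntries γ A =
        (g : Matrix (Fin m) (Fin m) ℂ).map C * A * ((h⁻¹ : GL (Fin m) ℂ) : Matrix (Fin m) (Fin m) ℂ).map C) :
    ∃ A' : Matrix (Fin (m * Γ'.relIndex Γ)) (Fin (m * Γ'.relIndex Γ)) (MvPolynomial σ ℂ),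
      (∀ γ ∈ Γ, ∃ G H : GL (Fin (m * Γ'.relIndex Γ)) ℂ,
        Matrix.linSubstEntries γ A' =
          (G : Matrix _ _ ℂ).map C * A' * ((H⁻¹ : GL (Fin (m * Γ'.relIndex Γ)) ℂ) : Matrix _ _ ℂ).map C) ∧
      (∃ reps : Fin (Γ'.relIndex Γ) → GL σ ℂ, (∀ i, reps i ∈ Γ) ∧
        A'.det = ∏ i, linSubst σ ℂ (reps i : Matrix σ σ ℂ) A.det) ∧
      ((∀ i j, (A i j).totalDegree ≤ 1) → ∀ i j, (A' i j).totalDegree ≤ 1) ∧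
      (A.IsSymm → A'.IsSymm) := by
  classical
  -- the cosets
  set H : Subgroup Γ := Γ'.subgroupOf Γ with hH
  let Q := Γ ⧸ H
  haveI : Fintype Q := Fintype.ofFinite Q
  -- `Fin (m * R)` re-indexing (`R = [Γ : Γ'] = Nat.card Q`)
  let eQ : Q ≃ Fin (Γ'.relIndex Γ) := Finite.equivFin Q
  let E : Fin m × Q ≃ Fin (m * Γ'.relIndex Γ) := ((Equiv.refl (Fin m)).prodCongr eQ).trans finProdFinEquiv
  -- the blocks
  let rep : Q → GL σ ℂ := fun q => ((Quotient.out q : Γ) : GL σ ℂ)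
  let B : Q → Matrix (Fin m) (Fin m) (MvPolynomial σ ℂ) := fun q => Matrix.linSubstEntries (rep q) A
  refine ⟨(blockDiagonal B).submatrix E.symm E.symm, ?_, ?_, ?_, ?_⟩
  · -- (T1) lifts
    intro γ hγ
    let γΓ : Γ := ⟨γ, hγ⟩
    let τ : Equiv.Perm Q := MulAction.toPerm γΓ
    -- `γ · rep q = rep (γ • q) · h₀ q` with `h₀ q ∈ Γ'`
    let h₀ : Q → Γ := fun q => (Quotient.out (τ q))⁻¹ * (γΓ * Quotient.out q)
    have hh₀ : ∀ q, (h₀ q : GL σ ℂ) ∈ Γ' := by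
      intro q
      have hq : ((Quotient.out (τ q) : Γ) : Q) = ((γΓ * Quotient.out q : Γ) : Q) := by
        rw [QuotientGroup.out_eq', ← smul_eq_mul, ← MulAction.Quotient.smul_coe, QuotientGroup.out_eq']
        rfl
      have := QuotientGroup.eq.mp hq
      exact Subgroup.mem_subgroupOf.mp this
    have hfac : ∀ q, γ * rep q = rep (τ q) * (h₀ q : GL σ ℂ) := by
      intro q
      show γ * ((Quotient.out q : Γ) : GL σ ℂ) =
        ((Quotient.out (τ q) : Γ) : GL σ ℂ) * (((Quotient.out (τ q))⁻¹ * (γΓ * Quotient.out q) : Γ) : GL σ ℂ)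
      rw [Subgroup.coe_mul, Subgroup.coe_mul, Subgroup.coe_inv, mul_inv_cancel_left]
    -- the `Γ'`-lifts of the `h₀ q`
    choose g h hgh using fun q => hlift _ (hh₀ q)
    -- block identity
    have hblock : ∀ q, Matrix.linSubstEntries γ (B q) =
        ((g q : GL (Fin m) ℂ) : Matrix (Fin m) (Fin m) ℂ).map C * B (τ q) *
          (((h q)⁻¹ : GL (Fin m) ℂ) : Matrix (Fin m) (Fin m) ℂ).map C := by
      intro q
      show Matrix.linSubstEntries γ (Matrix.linSubstEntries (rep q) A) = _
      rw [Matrix.linSubstEntries_linSubstEntries, hfac q, ← Matrix.linSubstEntries_linSubstEntries, hgh q,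
        Matrix.linSubstEntries_mul, Matrix.linSubstEntries_mul, Matrix.linSubstEntries_map_C,
        Matrix.linSubstEntries_map_C]
    -- the lifts on `Fin m × Q`
    let Gk : Matrix (Fin m × Q) (Fin m × Q) ℂ :=
      blockDiagonal (fun q => ((g q : GL (Fin m) ℂ) : Matrix (Fin m) (Fin m) ℂ)) *
        (1 : Matrix (Fin m × Q) (Fin m × Q) ℂ).submatrix ((Equiv.refl (Fin m)).prodCongr τ) id
    let Gki : Matrix (Fin m × Q) (Fin m × Q) ℂ :=
      (1 : Matrix (Fin m × Q) (Fin m × Q) ℂ).submatrix id ((Equiv.refl (Fin m)).prodCongr τ) *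
        blockDiagonal (fun q => (((g q)⁻¹ : GL (Fin m) ℂ) : Matrix (Fin m) (Fin m) ℂ))
    let Hk : Matrix (Fin m × Q) (Fin m × Q) ℂ :=
      blockDiagonal (fun q => ((h q : GL (Fin m) ℂ) : Matrix (Fin m) (Fin m) ℂ)) *
        (1 : Matrix (Fin m × Q) (Fin m × Q) ℂ).submatrix ((Equiv.refl (Fin m)).prodCongr τ) id
    let Hki : Matrix (Fin m × Q) (Fin m × Q) ℂ :=
      (1 : Matrix (Fin m × Q) (Fin m × Q) ℂ).submatrix id ((Equiv.refl (Fin m)).prodCongr τ) *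
        blockDiagonal (fun q => (((h q)⁻¹ : GL (Fin m) ℂ) : Matrix (Fin m) (Fin m) ℂ))
    have hGG : Gk * Gki = 1 := blockLift_mul_inv _ _ (fun q => by simp) τ
    have hGG' : Gki * Gk = 1 := blockLift_inv_mul _ _ (fun q => by simp) τ
    have hHH : Hk * Hki = 1 := blockLift_mul_inv _ _ (fun q => by simp) τ
    have hHH' : Hki * Hk = 1 := blockLift_inv_mul _ _ (fun q => by simp) τ
    -- the identity on `Fin m × Q`
    have hmain : Matrix.linSubstEntries γ (blockDiagonal B) =
        Gk.map C * blockDiagonal B * Hki.map C := by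
      rw [show Matrix.linSubstEntries γ (blockDiagonal B) = blockDiagonal (fun q => Matrix.linSubstEntries γ (B q)) by
        simp only [Matrix.linSubstEntries]; exact blockDiagonal_map _ _ (map_zero _)]
      rw [funext hblock, blockLift_map_C, blockLift_inv_map_C, blockLift_conj]
    -- re-index to `Fin (m * R)`
    have hsub : ∀ M N : Matrix (Fin m × Q) (Fin m × Q) ℂ, M * N = 1 →
        M.submatrix E.symm E.symm * N.submatrix E.symm E.symm = 1 := by
      intro M N hMN
      rw [Matrix.submatrix_mul_equiv, hMN, Matrix.submatrix_one_equiv]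
    refine ⟨⟨Gk.submatrix E.symm E.symm, Gki.submatrix E.symm E.symm, hsub _ _ hGG, hsub _ _ hGG'⟩,
      ⟨Hk.submatrix E.symm E.symm, Hki.submatrix E.symm E.symm, hsub _ _ hHH, hsub _ _ hHH'⟩, ?_⟩
    show Matrix.linSubstEntries γ ((blockDiagonal B).submatrix E.symm E.symm) =
      (Gk.submatrix E.symm E.symm).map C * (blockDiagonal B).submatrix E.symm E.symm *
        (Hki.submatrix E.symm E.symm).map C
    rw [show Matrix.linSubstEntries γ ((blockDiagonal B).submatrix ⇑E.symm ⇑E.symm) =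
        (Matrix.linSubstEntries γ (blockDiagonal B)).submatrix E.symm E.symm by
      simp only [Matrix.linSubstEntries, Matrix.submatrix_map]]
    rw [hmain, ← Matrix.submatrix_map, ← Matrix.submatrix_map, Matrix.submatrix_mul_equiv,
      Matrix.submatrix_mul_equiv]
  · -- (T2) determinant
    refine ⟨fun i => rep (eQ.symm i), fun i => ((Quotient.out (eQ.symm i) : Γ)).2, ?_⟩
    rw [Matrix.det_submatrix_equiv_self, Matrix.det_blockDiagonal]
    rw [← Fintype.prod_equiv eQ.symm (fun i => linSubst σ ℂ (rep (eQ.symm i) : Matrix σ σ ℂ) A.det)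
      (fun q => (B q).det) (fun i => ?_)]
    show linSubst σ ℂ (rep (eQ.symm i) : Matrix σ σ ℂ) A.det = (Matrix.linSubstEntries (rep (eQ.symm i)) A).det
    rw [Matrix.linSubstEntries, ← AlgHom.mapMatrix_apply, ← AlgHom.map_det]
  · -- affineness
    intro hdeg x y
    rw [Matrix.submatrix_apply, blockDiagonal_apply]
    split_ifs
    · exact totalDegree_linSubstEntries_le _ hdeg _ _
    · simp
  · -- symmetry
    intro hsym
    show ((blockDiagonal B).submatrix E.symm E.symm)ᵀ = (blockDiagonal B).submatrix E.symm E.symm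
    rw [Matrix.transpose_submatrix, blockDiagonal_transpose,
      show (fun q => (B q)ᵀ) = B from funext fun q => ?_]
    show (Matrix.linSubstEntries (rep q) A)ᵀ = Matrix.linSubstEntries (rep q) A
    rw [← Matrix.linSubstEntries_transpose, hsym.eq]

/-- **(T2) with an invariant determinant**: if `det A = f` and `f` is `Γ`-invariant, the induced block pencil has
determinant `f ^ [Γ : Γ']` — «product-type induction yields `f^R`, never `f`». [folklore] -/
theorem inducedBlock_of_invariant (Γ Γ' : Subgroup (GL σ ℂ)) [(Γ'.subgroupOf Γ).FiniteIndex]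
    (A : Matrix (Fin m) (Fin m) (MvPolynomial σ ℂ)) (f : MvPolynomial σ ℂ) (hdet : A.det = f)
    (hinv : ∀ γ ∈ Γ, linSubst σ ℂ (γ : Matrix σ σ ℂ) f = f)
    (hlift : ∀ γ ∈ Γ', ∃ g h : GL (Fin m) ℂ,
      Matrix.linSubstEntries γ A =
        (g : Matrix (Fin m) (Fin m) ℂ).map C * A * ((h⁻¹ : GL (Fin m) ℂ) : Matrix (Fin m) (Fin m) ℂ).map C) :
    ∃ A' : Matrix (Fin (m * Γ'.relIndex Γ)) (Fin (m * Γ'.relIndex Γ)) (MvPolynomial σ ℂ),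
      (∀ γ ∈ Γ, ∃ G H : GL (Fin (m * Γ'.relIndex Γ)) ℂ,
        Matrix.linSubstEntries γ A' =
          (G : Matrix _ _ ℂ).map C * A' * ((H⁻¹ : GL (Fin (m * Γ'.relIndex Γ)) ℂ) : Matrix _ _ ℂ).map C) ∧
      A'.det = f ^ Γ'.relIndex Γ ∧
      ((∀ i j, (A i j).totalDegree ≤ 1) → ∀ i j, (A' i j).totalDegree ≤ 1) ∧
      (A.IsSymm → A'.IsSymm) := by
  obtain ⟨A', hL, ⟨reps, hreps, hd⟩, haff, hsym⟩ := inducedBlock Γ Γ' A hlift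
  refine ⟨A', hL, ?_, haff, hsym⟩
  rw [hd, hdet, Finset.prod_congr rfl fun i _ => hinv _ (hreps i), Finset.prod_const, Finset.card_univ,
    Fintype.card_fin]

end Induced

/-! ### §3 The permanent is invariant under row/column permutation pairs; the obstruction for `Γ_n` -/

section PermPairs

/-- `per_n (P x Q) = per_n (x)`: the generic permanent is invariant under the substitution group `Γ_n` generated by the
permutation matrices of `π × ρ` (`linSubst_permMatrix` + the tree's `rename_prodMap_perPoly`, closure induction). [folklore] -/
theorem perPoly_linSubst_permPair (n : ℕ) :
    ∀ γ ∈ Subgroup.closure {γ : GL (Fin n × Fin n) ℂ | ∃ π ρ : Equiv.Perm (Fin n),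
        (γ : Matrix (Fin n × Fin n) (Fin n × Fin n) ℂ) = Equiv.Perm.permMatrix ℂ (Equiv.prodCongr π ρ)},
      linSubst (Fin n × Fin n) ℂ (γ : Matrix (Fin n × Fin n) (Fin n × Fin n) ℂ) (perPoly (Fin n) ℂ) = perPoly (Fin n) ℂ := by
  intro γ hγ
  induction hγ using Subgroup.closure_induction with
  | mem x hx =>
    obtain ⟨π, ρ, hx⟩ := hx
    rw [hx, linSubst_permMatrix, Equiv.prodCongr_symm, Equiv.prodCongr_apply]
    -- `per (x_{π⁻¹ i, ρ⁻¹ j}) = per (x)` — the computation of the tree's `rename_prodMap_perPoly` (FreeSubtorus floor), inlined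
    -- to keep this file route-independent: reindex `θ ↦ π⁻¹ ∘ θ ∘ ρ`, then the product by `ρ⁻¹`.
    simp only [perPoly, Matrix.permanent, map_sum, map_prod, Matrix.mvPolynomialX_apply, rename_X, Prod.map_apply]
    refine Fintype.sum_equiv (ρ.symm.equivCongr π.symm) _ _ fun θ => ?_
    refine Fintype.prod_equiv ρ.symm _ _ fun i => ?_
    simp [Equiv.equivCongr_apply_apply]
  | one => rw [Units.val_one, linSubst_one]; rfl
  | mul x y _ _ hx hy => rw [Units.val_mul, linSubst_mul, AlgHom.comp_apply, hy, hx]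
  | inv x _ hx =>
    conv_lhs => rw [← hx]
    rw [← AlgHom.comp_apply, ← linSubst_mul, ← Units.val_mul, inv_mul_cancel, Units.val_one, linSubst_one]
    rfl

/-- **(I1) for `Γ_n` — the located obstruction.**  For `Γ = Γ_n` (row/column permutation pairs, the Birth skeleton's
`permPairSubst n` written out), `Γ' ≤ Γ_n` of finite index `R` and a symmetric `Γ'`-equivariant affine pencil `A` of `per_n`
of size `m`, the induced block pencil is a SYMMETRIC AFFINE pencil of size `m R` with `Γ_n`-LIFTS and determinant `per_n ^ R`:
a `Γ_n`-equivariant representation of `per_n ^ R`, not of `per_n` (for `R ≥ 2`). [cite: LandsbergRessayre2017, Def. 1.3] -/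
theorem inducedBlock_permPairs (n m : ℕ) (Γ Γ' : Subgroup (GL (Fin n × Fin n) ℂ))
    (hΓ : Γ = Subgroup.closure {γ : GL (Fin n × Fin n) ℂ | ∃ π ρ : Equiv.Perm (Fin n),
        (γ : Matrix (Fin n × Fin n) (Fin n × Fin n) ℂ) = Equiv.Perm.permMatrix ℂ (Equiv.prodCongr π ρ)})
    [(Γ'.subgroupOf Γ).FiniteIndex]
    (A : Matrix (Fin m) (Fin m) (MvPolynomial (Fin n × Fin n) ℂ)) (hsym : A.IsSymm)
    (hA : IsEquivariantDetRepr Γ' (perPoly (Fin n) ℂ) A) :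
    ∃ A' : Matrix (Fin (m * Γ'.relIndex Γ)) (Fin (m * Γ'.relIndex Γ)) (MvPolynomial (Fin n × Fin n) ℂ),
      A'.IsSymm ∧ (∀ i j, (A' i j).totalDegree ≤ 1) ∧
      (∀ γ ∈ Γ, ∃ G H : GL (Fin (m * Γ'.relIndex Γ)) ℂ, Matrix.linSubstEntries γ A' =
          (G : Matrix _ _ ℂ).map C * A' * ((H⁻¹ : GL (Fin (m * Γ'.relIndex Γ)) ℂ) : Matrix _ _ ℂ).map C) ∧
      A'.det = perPoly (Fin n) ℂ ^ Γ'.relIndex Γ := by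
  have hinv : ∀ γ ∈ Γ, linSubst (Fin n × Fin n) ℂ (γ : Matrix (Fin n × Fin n) (Fin n × Fin n) ℂ) (perPoly (Fin n) ℂ) =
      perPoly (Fin n) ℂ := by
    rw [hΓ]; exact perPoly_linSubst_permPair n
  obtain ⟨A', hL, hd, haff, hs⟩ := inducedBlock_of_invariant Γ Γ' A (perPoly (Fin n) ℂ) hA.1.2 hinv hA.2
  exact ⟨A', hs hsym, haff hA.1.1, hL, hd⟩

end PermPairs

end

end Summit.ValiantsHypothesis.ValiantsHypothesis.Theorems.SymPencilSymmetrizePermPairs.InducedBlock
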